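import Literature.MathematicalPhysics.QuantumFieldTheory.Balaban1983to89.B9SectCDiffCutModelToy7

/-!
# `Balaban1983to89.B9SectCDiffCutModelToy8` — the WOODBURY COARSE OPERATOR of the one-level toy: with the Leibniz
block `Λ = 2ν + ∂∂*` (Toy4 §6, `b = 1`) the coarse operator of the sequence datum `G` is `M_C = ½(E₂ + ν·E₃(ν))`,
`E₃(ν) = Q′G′(∂*∂ + ν)⁻¹G′Q′*` — a non-negative perturbation of `½E₂`; its off-diagonal weighted row mass, its inverse
`M_C⁻¹ ∈ 𝒟(0, −4, 6a⁴)` on the toy frame for `2²⁰ ≤ a ≤ B`, and the push-through / Woodbury matrix identities giving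
`G` in closed form with `G·(Λ + 0 + ∂(1 − G′Q′ᵗCQ′G′)∂*) = 1` (census `b2b-balaban-r1/SectC-inst-census.md` §6 (a⁵)
ff.; notes N12–N14)

B9 = T. Bałaban, *Propagators for lattice gauge theories in a background field*, Commun. Math. Phys. **99**, 389–434
(1985) [Balaban1985BackgroundPropagators].

CITATION HEADER (lean-in-tree rule 2026-08-18).  Cell `pub-balaban`, unit `b2b-balaban-r1-g17` (READER GROUP A,
lineage r1, gen 17), journal claim `SECTC-DIFF-CUTMODEL-TOY8` (second leaf of the seat, after `…Toy7` under claim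
`SECTC-DIFF-CUTMODEL-TOY7`).  Source: doi:10.1007/bf01240355, held `paper:balaban1985-cmp99-background-propagators`,
journal page = PDF page + 388.  This unit re-read NO page and introduces NO quotation: the only printed shapes
inhabited here are (i) the target shape of the coarse sequence datum, `MOne.mC : OpDec F bS bS p p 0 (−4) c C` of
`…B9SectCDiffAssembly`, which carries the scale power of B9's Theorem 3.2 (3.48), p. 398 [PDF 10] (sentence quoted
VERBATIM in the header of `…B9SectCDiffAssembly`; the classes `𝒟(n, k, c)` transcribe Theorem 3.1 (3.42), p. 397
[PDF 9], quoted in the header of `…B9SectCDiffEstimate`), and (ii) the SHAPES of the three proof fields `hG'₁`, `hC₁`,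
`hG₁` of the structure `TwoSeq` of `…B9SectCDiffExpansion` (our typing of the two-sequence skeleton; no printed
sentence); the present declarations point to those quotations BY NAME only.  Tree inputs (by name):
`B9SectCDiffEstimate.{Frame, OpDec}` (via `B9SectCDiffCutModelToy6.opDec_coarse_of_rowLe`),
`B9SectCDiffCutModelToy.{bdist, Qp}`, `B9SectCDiffCutModelToy2.Qpt`, `B9SectCDiffCutModelToy3.toyFrame`,
`B9SectCDiffCutModelToy4.{Dfw, Dbw}`, `B9SectCDiffCutModelToy5.{Hm, Gr, Gr_mul_Hm, Gr_nonneg}`,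
`B9SectCDiffCutModelToy6.{Hd, Gd, Hd_mul_Gd, IsWt.nonneg, RowLe, RowLe.inv_of_diag, ewt, isWt_ewt,
opDec_coarse_of_rowLe, E2, E2_apply, Gr_symm}`, `B9SectCDiffCutModelToy7.{R0, R1, c1, btail, TL, odB, Tob, R0_pos,
R1_pos, c1_pos, TL_pos, btail_nonneg, E2_nonneg, sum_offblocks_eq, sum_split_block, Tob_in_le, Tob_le,
Gr_block_colsum_le, Gr_rowsum_le, sum_btail_le, E2_offdiag_weighted_le, rowLe_of_offdiag, rowLe_mono, srate_eq,
R0_num_le, R1_num_le, c1_num_le, TL_num_le, odB_num_le, E2_diag_ge_num, constant_num, isUnit_E2_num}`; Mathlib's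
`Matrix.{mul_nonsing_inv, nonsing_inv_mul, isUnit_iff_isUnit_det}`, `mul_eq_one_comm` otherwise.  Cell rows: GAPS
C-r1g13-1 (the cut model), C-r1g14-1 … C-r1g17-1 (the toys 1–7), this module's row C-r1g17-3; census §6 (a⁵) /
notes N10–N14.  No `HarnessLib` fact, no named-fact `Prop`, no `instance`, no new predicate (Toy6's `RowLe` is PROVED
here for `1 − D⁻¹M_C` and, through Toy6's engine, for `M_C⁻¹`); no `sorry`.

## WHAT THIS MODULE DOES

Toy6 (gen 16; its header and census N12) wrote, for `Λ = λ·1` and `A = 0`, the Woodbury form of the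
cut model's sequence datum `G = (Λ + A + ∂(1 − P)∂*)⁻¹`, `P = G′Q′ᵗCQ′G′`: `G = G₀ + G₀∂G′Q′ᵗ·(λE₃)⁻¹·Q′G′∂*G₀`
with `G₀ = (λ + ∂∂*)⁻¹`, `E₃ = Q′G′(λ + ∂*∂)⁻¹G′Q′ᵗ`, and Toy7 (this seat's first leaf) inverted the FIRST coarse
operator `E₂ = Q′G′²Q′ᵗ = C⁻¹` in the class `𝒟(0, −4, 3a⁴)`; inverting `λE₃` the same way needs the diagonal of
`E₃` from below (census N13: not done) — the hard half.  THE OBSERVATION OF THIS LEAF: the Leibniz block as actually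
instantiated in Toy4 §6 is `Λ = λ·1 + b·∂∂*` at `b = 1` (`leibniz_affine`, zone classes `h4_zLm₁` / `h4_zLm₀`), and
then (write `λ = 2ν`) `Λ + ∂∂* = 2(∂∂* + ν) = 2H₀,ν`, so `G₀ = ½·Gd(ν)`, and the push-through identity
`∂*(∂∂* + ν)⁻¹∂ = 1 − ν(∂*∂ + ν)⁻¹` turns the general Woodbury coarse operator `M_C := C⁻¹ − Q′G′∂*G₀∂G′Q′ᵗ` into
`M_C = E₂ − ½Q′G′(1 − ν·Gr(ν))G′Q′ᵗ = ½(E₂ + ν·E₃(ν))`, `E₃(ν) := Q′·G′Gr(ν)G′·Q′ᵗ ≥ 0` ENTRYWISE — a non-negative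
perturbation of `½E₂`.  Hence `M_C`'s diagonal is `≥ ½E₂(I,I)`, FREE from Toy7, and only the off-diagonal weighted
mass of `E₃` is new: one more convolution layer over Toy7's out-of-block mass `T_I`.

* §1 the generic coarse sandwich `Qp·M·Qpt`: entries (`coarse_apply`), sign (`coarse_nonneg`), and the
  rearrangement of its off-diagonal weighted row mass `Σ_{J≠I}(Qp·M·Qpt)(I,J)e^{κ|I−J|} = B⁻¹Σ_{x∈I}Σ_{z∉I}
  M(x,z)e^{κ|I−blk z|}` (`coarse_offdiag_weighted_eq`);
* §2 `E3 n B μ ν := Qp·(Gr μ·Gr ν·Gr μ)·Qpt`, its entries and sign (`E3_apply`, `E3_nonneg`);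
* §3 THE OFF-DIAGONAL WEIGHTED ROW MASS OF `E₃` at `μ = m²`, `ν = l²` (`0 < m, l ≤ 1`, `κ ≥ 0`, net rates
  `s_m = m/2 − κ/B > 0`, `s_l = l/2 − κ/B > 0`): with `T³_I(w) := Σ_{w'} Gr(l²)(w,w')T_I^{(m)}(w')` (`Tob3`) the
  rearrangement `Σ_{J≠I}E₃(I,J)e^{κ|I−J|} = B⁻¹Σ_{x∈I}Σ_w G′(x,w)T³_I(w)` (`E3_offdiag_weighted_eq`); the first layer
  `T³_I(w) ≤ c₁(m)·Σ_{w'∈I}Gr(l²)(w,w')·tails_m(o(w')) + R₁(m)·T_I^{(l)}(w)` (`Tob3_le`, Toy7's `Tob_in_le` /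
  `Tob_le`); the second layer by two column sums (`Gr_block_colsum_le`, `Gr_colsum_le`) and the two-mass version of
  Toy7's main estimate (`mixed_offdiag_le : Σ_{x∈I}Σ_w Gr(m²)(x,w)T_I^{(l)}(w) ≤ R₀(m)c₁(l)T_L(l) + R₁(l)c₁(m)T_L(m)`):
  **`E3_offdiag_weighted_le : Σ_{J≠I} E₃(m², l²)(I,J)e^{κ|I−J|} ≤ odB3 := B⁻¹[c₁(m)T_L(m)·R₀(m)R₀(l) +
  R₁(m)·(R₀(m)c₁(l)T_L(l) + R₁(l)c₁(m)T_L(m))]`** — of size `O(B⁶/a⁷)` at `m = l = a/B`;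
* §4 `MC n B μ ν := ½·(E2 μ + ν·E3 μ ν)`: `MC_nonneg`, **`MC_diag_ge`** (`E₂(I,I) ≥ d ⇒ M_C(I,I) ≥ d/2`),
  `MC_offdiag_weighted_le` (`≤ ½(odB + l²·odB3)`), hence with Toy7's `rowLe_of_offdiag` and Toy6's engine
  **`isUnit_MC_inv_rowLe`** (`(odB + l²odB3)/d < 1 ⇒ IsUnit M_C ∧ RowLe (ewt κ) M_C⁻¹ ((1 − q)⁻¹(d/2)⁻¹)`) and
  **`MC_inv_opDec`** (`2(odB + l²odB3) ≤ d`, `4d⁻¹ ≤ cB⁻⁴`, `0 ≤ κ`, `δ₀ ≤ κ` ⇒ `M_C⁻¹ ∈ 𝒟(0, −4, c)` on `toyFrame`);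
* §5 THE NUMERIC COROLLARY at `κ = 1/2`, `μ = ν = (a/B)²`: `odB3 ≤ 376320·B⁶/(a³(a−1)⁴)` (`odB3_num_le`, from
  Toy7's `R₀ ≤ 24B²/a²`, `R₁ ≤ 40B²/(a(a−1))`, `c₁T_L ≤ 120B³/(a(a−1)²)`), total `odB + (a/B)²odB3 ≤
  384000·B⁴/(a(a−1)⁴)` (`offmass_num_le`) against Toy7's diagonal `E₂(I,I) ≥ B⁴(a−6)²/a⁶`; `768000a⁵ ≤
  (a−1)⁴(a−6)²` for `a ≥ 2²⁰ = 1048576` (`threshold_poly3`) gives the dominance, `2a² ≤ 3(a−6)²` the constant: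
  **`isUnit_MC_num`** and **`MC_inv_opDec_num : M_C((a/B)², (a/B)²)⁻¹ ∈ 𝒟(0, −4, 6a⁴)`** on `toyFrame n B N hN δ₀`
  for `2²⁰ ≤ a ≤ B`, `δ₀ ≤ 1/2` — constants free of `B`, `n`, `N`;
* §6 THE MATRIX IDENTITIES: the abstract Woodbury identity with rectangular `U`, `V` (`woodbury_mul_eq_one : G₀H = 1
  → EC = 1 → VG₀U = E − M → M⁻M = 1 → (G₀ + G₀UM⁻VG₀)(H − UCV) = 1`); the push-through identity
  **`Dbw_Gd_Dfw : ∂*·Gd(ν)·∂ = 1 − ν·Gr(ν)`** (from `H_ν∂* = ∂*H₀,ν`, Toy5/Toy6); `Lam n B ν := 2ν·1 + ∂∂*`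
  (`Lam_eq_affine`: Toy4's `a·1 + b·∂∂*` at `a = 2ν`, `b = 1`), `G0 n B ν := ½·Gd ν` with `G0_mul :
  G₀(Λ + ∂∂*) = 1`; **`VG0U_eq : Q′G′∂*·G₀·∂G′Q′ᵗ = E₂ − M_C`**; the closed form
  `Gtoy n B μ ν := G₀ + G₀(∂G′Q′ᵗ)M_C⁻¹(Q′G′∂*)G₀` and **`Gtoy_mul_eq_one : IsUnit E₂ → IsUnit M_C →
  Gtoy·(Λ + 0 + ∂(1 − G′Q′ᵗE₂⁻¹Q′G′)∂*) = 1`** — literally the SHAPE of the field `TwoSeq.hG₁` with `D = ∂ ≠ 0`,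
  `A₁ = 0`, `C₁ = E₂⁻¹`; the companion shapes `Gr_hG'_shape` (`hG'₁`, Toy5) and `E2inv_hC_shape` (`hC₁`); and the
  numeric instance **`Gtoy_mul_eq_one_num`** for `2²⁰ ≤ a ≤ B` (invertibility from Toy7's `isUnit_E2_num` and §5).

## WHAT IS NOT CLAIMED (ABSOLUTE RULE)

Nothing printed is asserted.  Everything here is finite sums of exponentials, finite-dimensional linear algebra and the
one-dimensional discrete Helmholtz kernel bounds of Toy5 (folklore); B9's Theorems 3.1–3.3 concern gauge-covariant
operators in a background field on a four-dimensional multi-level lattice, and nothing here bears on them or on their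
printed proofs — the dominance argument is the GENERIC weighted-`ℓ^∞` one of Toy6/Toy7, not B9's (3.47)–(3.61), and
the Woodbury algebra of §6 is textbook linear algebra, not B9's (3.63) ff.  HONEST CAVEATS: (1) the threshold
`a ≥ 2²⁰` and the constants `6a⁴`, `376320`, `384000` are artefacts of the crude inputs (`4/m`, rate `m/2`) of Toy5's
`Gr_mass_le` and of wasteful triangle inequalities; the true relative size of the off-diagonal mass is `O(1/a)` with
a constant of order ten; no optimisation was attempted; (2) the choice `Λ = 2ν + ∂∂*` (`b = 1`, `λ = 2ν`) and
`ν = μ` in §5 are OURS — any `b > 0` gives `M_C = (1+b)⁻¹(bE₂ + νE₃(ν))`, `ν = λ/(1+b)`, by the same two lines, while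
`b = 0` (`Λ = λ·1`) gives `M_C = λE₃(λ)` and WOULD need the diagonal of `E₃` from below (census N12's harder reading,
not done); (3) `Gtoy` is exhibited as a LEFT inverse in the `hG₁` shape only; its membership in the classes `𝒟`/`𝓜`
of the cut model (products and sums of the class members `G₀ = ½Gd` (Toy6 `Gd_opDec`), `∂G′`, `M_C⁻¹`), the
packaging with Toy4's Leibniz block and gen 15's Q-records into a `TwoSeq` / `CutModel` / `EstHyp` instance with
`∂ ≠ 0`, and an `n`-free majorant profile are NOT done (census §6 (a⁵) ff., note N14).  Value = kernel certificate
that BOTH coarse inversions of the toy's sequence datum close in the class the cut model demands, with explicit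
absolute constants, and that the datum `G` exists in closed form satisfying the `hG₁` equation — NOT summit progress.
-/

namespace Literature.MathematicalPhysics.QuantumFieldTheory.Balaban1983to89.B9SectCDiffCutModelToy8

open Finset Real
open B9SectCDiffEstimate
open B9SectCDiffCutModel
open B9SectCDiffCutModelToy
open B9SectCDiffCutModelToy2
open B9SectCDiffCutModelToy3
open B9SectCDiffCutModelToy4
open B9SectCDiffCutModelToy5
open B9SectCDiffCutModelToy6
open B9SectCDiffCutModelToy7

noncomputable section

/-! ## §1 The generic coarse sandwich `Qp·M·Qpt`: entries, sign, off-diagonal weighted row mass -/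

section Coarse

variable {n B : ℕ}

/-- the entries of a coarse sandwich: `(Qp·M·Qpt)(I,J) = B⁻¹ Σ_{x∈I} Σ_{z∈J} M(x,z)` (Toy6's `E2_apply` with a
generic middle factor). [folklore] -/
theorem coarse_apply (M : Matrix (Fin n × Fin B) (Fin n × Fin B) ℝ) (I J : Fin n) :
    (Qp n B * M * Qpt n B) I J = (B : ℝ)⁻¹ * ∑ x ∈ univ.filter (fun x : Fin n × Fin B => x.1 = I),
      ∑ z ∈ univ.filter (fun z : Fin n × Fin B => z.1 = J), M x z := by
  rw [Matrix.mul_apply]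
  have h1 : ∀ z, (Qp n B * M) I z
      = (B : ℝ)⁻¹ * ∑ x ∈ univ.filter (fun x : Fin n × Fin B => x.1 = I), M x z := by
    intro z
    rw [Matrix.mul_apply, Finset.sum_filter, Finset.mul_sum]
    refine sum_congr rfl fun x _ => ?_
    unfold Qp
    split_ifs <;> simp
  simp_rw [h1]
  have h2 : ∀ z, Qpt n B z J = if z.1 = J then (1 : ℝ) else 0 := fun z => rfl
  simp_rw [h2, mul_ite, mul_one, mul_zero]
  rw [← Finset.sum_filter, ← Finset.mul_sum, Finset.sum_comm]

/-- a coarse sandwich of an entrywise non-negative matrix is entrywise non-negative. [folklore] -/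
theorem coarse_nonneg {M : Matrix (Fin n × Fin B) (Fin n × Fin B) ℝ} (hM : ∀ x z, 0 ≤ M x z) (I J : Fin n) :
    0 ≤ (Qp n B * M * Qpt n B) I J := by
  rw [coarse_apply]
  exact mul_nonneg (inv_nonneg.mpr (Nat.cast_nonneg _))
    (sum_nonneg fun x _ => sum_nonneg fun z _ => hM x z)

/-- **the off-diagonal weighted row mass of a coarse sandwich, rearranged**:
`Σ_{J≠I} (Qp·M·Qpt)(I,J)·e^{κ|I−J|} = B⁻¹ Σ_{x∈I} Σ_{z∉I} M(x,z)·e^{κ|I − blk z|}` (a finite rearrangement, Toy7's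
`sum_offblocks_eq`). [folklore] -/
theorem coarse_offdiag_weighted_eq (M : Matrix (Fin n × Fin B) (Fin n × Fin B) ℝ) (κ : ℝ) (I : Fin n) :
    ∑ J ∈ univ.filter (fun J : Fin n => J ≠ I), (Qp n B * M * Qpt n B) I J * ewt n κ I J
      = (B : ℝ)⁻¹ * ∑ x ∈ univ.filter (fun x : Fin n × Fin B => x.1 = I),
          ∑ z ∈ univ.filter (fun z : Fin n × Fin B => z.1 ≠ I), M x z * ewt n κ I z.1 := by
  have h1 : ∀ J, (Qp n B * M * Qpt n B) I J * ewt n κ I J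
      = (B : ℝ)⁻¹ * ∑ x ∈ univ.filter (fun x : Fin n × Fin B => x.1 = I),
          ∑ z ∈ univ.filter (fun z : Fin n × Fin B => z.1 = J), M x z * ewt n κ I J := by
    intro J
    rw [coarse_apply, mul_assoc, sum_mul]
    congr 1
    exact sum_congr rfl fun x _ => sum_mul _ _ _
  simp_rw [h1]
  rw [← mul_sum, sum_comm (s := univ.filter (fun J : Fin n => J ≠ I))]
  congr 1
  refine sum_congr rfl fun x _ => ?_
  exact sum_offblocks_eq I (fun z J => M x z * ewt n κ I J)

end Coarse

/-! ## §2 The second coarse operator `E₃(μ, ν) := Qp·(G′(μ)·G_r(ν)·G′(μ))·Qpt` -/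

section E3def

variable {n B : ℕ} {μ ν : ℝ}

/-- **the second coarse operator of the Woodbury form**: `E₃(μ, ν) := Qp·(G_r(μ)·G_r(ν)·G_r(μ))·Qpt` — the coarse
sandwich of `G′·(∂*∂ + ν)⁻¹·G′` with `G′ = G_r(μ)` (Toy5's `Gr`), arising from the push-through identity
`∂*(Λ + ∂∂*)⁻¹∂ = ½(1 − ν·G_r(ν))` at `Λ = 2ν + ∂∂*` (§6 below). [folklore] -/
def E3 (n B : ℕ) (μ ν : ℝ) : Matrix (Fin n) (Fin n) ℝ :=
  Qp n B * (Gr n B μ * Gr n B ν * Gr n B μ) * Qpt n B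

/-- the entries of the triple product `G′·K·G′`. [folklore] -/
theorem GKG_apply (μ ν : ℝ) (x z : Fin n × Fin B) :
    (Gr n B μ * Gr n B ν * Gr n B μ) x z = ∑ w, Gr n B μ x w * ∑ w', Gr n B ν w w' * Gr n B μ w' z := by
  rw [Matrix.mul_assoc, Matrix.mul_apply]
  exact sum_congr rfl fun w _ => by rw [Matrix.mul_apply]

/-- the triple product is entrywise non-negative for `μ, ν > 0`. [folklore] -/
theorem GKG_nonneg (hμ : 0 < μ) (hν : 0 < ν) (x z : Fin n × Fin B) :
    0 ≤ (Gr n B μ * Gr n B ν * Gr n B μ) x z := by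
  rw [GKG_apply]
  exact sum_nonneg fun w _ => mul_nonneg (Gr_nonneg hμ x w)
    (sum_nonneg fun w' _ => mul_nonneg (Gr_nonneg hν w w') (Gr_nonneg hμ w' z))

/-- the entries of `E₃`: `E₃(I,J) = B⁻¹ Σ_{x∈I} Σ_{z∈J} (G′KG′)(x,z)`. [folklore] -/
theorem E3_apply (μ ν : ℝ) (I J : Fin n) :
    E3 n B μ ν I J = (B : ℝ)⁻¹ * ∑ x ∈ univ.filter (fun x : Fin n × Fin B => x.1 = I),
      ∑ z ∈ univ.filter (fun z : Fin n × Fin B => z.1 = J), (Gr n B μ * Gr n B ν * Gr n B μ) x z :=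
  coarse_apply _ I J

/-- `E₃` is entrywise non-negative for `μ, ν > 0`. [folklore] -/
theorem E3_nonneg (hμ : 0 < μ) (hν : 0 < ν) (I J : Fin n) : 0 ≤ E3 n B μ ν I J :=
  coarse_nonneg (GKG_nonneg hμ hν) I J

/-- the off-diagonal weighted row mass of `E₃`, generic rearrangement. [folklore] -/
theorem E3_offdiag_weighted_eq' (μ ν κ : ℝ) (I : Fin n) :
    ∑ J ∈ univ.filter (fun J : Fin n => J ≠ I), E3 n B μ ν I J * ewt n κ I J
      = (B : ℝ)⁻¹ * ∑ x ∈ univ.filter (fun x : Fin n × Fin B => x.1 = I),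
          ∑ z ∈ univ.filter (fun z : Fin n × Fin B => z.1 ≠ I),
            (Gr n B μ * Gr n B ν * Gr n B μ) x z * ewt n κ I z.1 :=
  coarse_offdiag_weighted_eq _ κ I

end E3def

/-! ## §3 The off-diagonal weighted row mass of `E₃` (one more convolution layer over Toy7's `Tob`) -/

section OffDiag3

variable {n B : ℕ} {m l κ : ℝ}

/-- the full COLUMN sums of `G_r(l²)` from above, by symmetry: `Σ_w G_r(w,w') ≤ R₀(l)`. [folklore] -/
theorem Gr_colsum_le (hl0 : 0 < l) (hl1 : l ≤ 1) (w' : Fin n × Fin B) :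
    ∑ w, Gr n B (l ^ 2) w w' ≤ R0 l := by
  unfold R0
  calc ∑ w, Gr n B (l ^ 2) w w' = ∑ w, Gr n B (l ^ 2) w' w := sum_congr rfl fun w _ => Gr_symm _ w w'
    _ ≤ _ := Gr_rowsum_le hl0 hl1 w'

/-- **the mixed double sum with two masses** (Toy7's `E2_offdiag_weighted_le` with the outer kernel at mass `m` and
the inner out-of-block mass `T_I` at mass `l`): `Σ_{x∈I}Σ_w G_r(m²)(x,w)·T_I^{(l)}(w) ≤ R₀(m)·c₁(l)T_L(l) +
R₁(l)·c₁(m)T_L(m)`. [folklore] -/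
theorem mixed_offdiag_le (hm0 : 0 < m) (hm1 : m ≤ 1) (hl0 : 0 < l) (hl1 : l ≤ 1) (hκ : 0 ≤ κ) (hB : 0 < B)
    (hsm : 0 < m / 2 - κ / B) (hsl : 0 < l / 2 - κ / B) (I : Fin n) :
    ∑ x ∈ univ.filter (fun x : Fin n × Fin B => x.1 = I), ∑ w, Gr n B (m ^ 2) x w * Tob n B (l ^ 2) κ I w
      ≤ R0 m * (c1 B l κ * TL B l κ) + R1 B l κ * (c1 B m κ * TL B m κ) := by
  have hμ : 0 < m ^ 2 := by positivity
  have hG0 : ∀ x w, 0 ≤ Gr n B (m ^ 2) x w := Gr_nonneg hμ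
  have hc1m : 0 ≤ c1 B m κ := (c1_pos hm0 hsm).le
  have hc1l : 0 ≤ c1 B l κ := (c1_pos hl0 hsl).le
  have hR1l : 0 ≤ R1 B l κ := (R1_pos hl0 hsl).le
  have hR0 : 0 ≤ R0 m := (R0_pos hm0).le
  have hbtl : ∀ w : Fin n × Fin B, 0 ≤ btail B (l / 2 - κ / B) w.2.val := fun w => btail_nonneg _ _ _
  have hTin : ∀ w ∈ univ.filter (fun w : Fin n × Fin B => w.1 = I),
      Tob n B (l ^ 2) κ I w ≤ c1 B l κ * btail B (l / 2 - κ / B) w.2.val :=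
    fun w hw => Tob_in_le hl0 hl1 hκ hB hsl (mem_filter.mp hw).2
  have hTout : ∀ w, Tob n B (l ^ 2) κ I w ≤ ewt n κ I w.1 * R1 B l κ :=
    fun w => Tob_le hl0 hl1 hκ hB hsl I w
  have htailsl : ∑ w ∈ univ.filter (fun w : Fin n × Fin B => w.1 = I), btail B (l / 2 - κ / B) w.2.val
      ≤ TL B l κ := by
    unfold TL; exact sum_btail_le hsl I
  have htailsm : ∑ w ∈ univ.filter (fun w : Fin n × Fin B => w.1 = I), btail B (m / 2 - κ / B) w.2.val
      ≤ TL B m κ := by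
    unfold TL; exact sum_btail_le hsm I
  have hxout : ∀ x ∈ univ.filter (fun x : Fin n × Fin B => x.1 = I),
      ∑ w ∈ univ.filter (fun w : Fin n × Fin B => w.1 ≠ I), Gr n B (m ^ 2) x w * ewt n κ I w.1
        ≤ c1 B m κ * btail B (m / 2 - κ / B) x.2.val :=
    fun x hx => Tob_in_le hm0 hm1 hκ hB hsm (mem_filter.mp hx).2
  -- sites `w ∈ I`
  have piece1 : ∑ x ∈ univ.filter (fun x : Fin n × Fin B => x.1 = I),
      ∑ w ∈ univ.filter (fun w : Fin n × Fin B => w.1 = I), Gr n B (m ^ 2) x w * Tob n B (l ^ 2) κ I w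
        ≤ R0 m * (c1 B l κ * TL B l κ) := by
    calc ∑ x ∈ univ.filter (fun x : Fin n × Fin B => x.1 = I),
          ∑ w ∈ univ.filter (fun w : Fin n × Fin B => w.1 = I), Gr n B (m ^ 2) x w * Tob n B (l ^ 2) κ I w
        ≤ ∑ x ∈ univ.filter (fun x : Fin n × Fin B => x.1 = I),
            ∑ w ∈ univ.filter (fun w : Fin n × Fin B => w.1 = I),
              Gr n B (m ^ 2) x w * (c1 B l κ * btail B (l / 2 - κ / B) w.2.val) :=
          sum_le_sum fun x _ => sum_le_sum fun w hw => mul_le_mul_of_nonneg_left (hTin w hw) (hG0 x w)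
      _ = ∑ w ∈ univ.filter (fun w : Fin n × Fin B => w.1 = I),
            (∑ x ∈ univ.filter (fun x : Fin n × Fin B => x.1 = I), Gr n B (m ^ 2) x w)
              * (c1 B l κ * btail B (l / 2 - κ / B) w.2.val) := by
          rw [sum_comm]
          exact sum_congr rfl fun w _ => (sum_mul _ _ _).symm
      _ ≤ ∑ w ∈ univ.filter (fun w : Fin n × Fin B => w.1 = I),
            R0 m * (c1 B l κ * btail B (l / 2 - κ / B) w.2.val) :=
          sum_le_sum fun w _ => mul_le_mul_of_nonneg_right (Gr_block_colsum_le hm0 hm1 I w)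
            (mul_nonneg hc1l (hbtl w))
      _ = R0 m * (c1 B l κ * ∑ w ∈ univ.filter (fun w : Fin n × Fin B => w.1 = I),
            btail B (l / 2 - κ / B) w.2.val) := by
          rw [mul_sum, mul_sum]
      _ ≤ R0 m * (c1 B l κ * TL B l κ) :=
          mul_le_mul_of_nonneg_left (mul_le_mul_of_nonneg_left htailsl hc1l) hR0
  -- sites `w ∉ I`
  have piece2 : ∑ x ∈ univ.filter (fun x : Fin n × Fin B => x.1 = I),
      ∑ w ∈ univ.filter (fun w : Fin n × Fin B => w.1 ≠ I), Gr n B (m ^ 2) x w * Tob n B (l ^ 2) κ I w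
        ≤ R1 B l κ * (c1 B m κ * TL B m κ) := by
    calc ∑ x ∈ univ.filter (fun x : Fin n × Fin B => x.1 = I),
          ∑ w ∈ univ.filter (fun w : Fin n × Fin B => w.1 ≠ I), Gr n B (m ^ 2) x w * Tob n B (l ^ 2) κ I w
        ≤ ∑ x ∈ univ.filter (fun x : Fin n × Fin B => x.1 = I),
            ∑ w ∈ univ.filter (fun w : Fin n × Fin B => w.1 ≠ I),
              Gr n B (m ^ 2) x w * (ewt n κ I w.1 * R1 B l κ) :=
          sum_le_sum fun x _ => sum_le_sum fun w _ => mul_le_mul_of_nonneg_left (hTout w) (hG0 x w)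
      _ = ∑ x ∈ univ.filter (fun x : Fin n × Fin B => x.1 = I),
            (∑ w ∈ univ.filter (fun w : Fin n × Fin B => w.1 ≠ I), Gr n B (m ^ 2) x w * ewt n κ I w.1)
              * R1 B l κ := by
          refine sum_congr rfl fun x _ => ?_
          rw [sum_mul]
          exact sum_congr rfl fun w _ => (mul_assoc _ _ _).symm
      _ ≤ ∑ x ∈ univ.filter (fun x : Fin n × Fin B => x.1 = I),
            (c1 B m κ * btail B (m / 2 - κ / B) x.2.val) * R1 B l κ :=
          sum_le_sum fun x hx => mul_le_mul_of_nonneg_right (hxout x hx) hR1l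
      _ = R1 B l κ * (c1 B m κ * ∑ x ∈ univ.filter (fun x : Fin n × Fin B => x.1 = I),
            btail B (m / 2 - κ / B) x.2.val) := by
          rw [mul_sum, mul_sum]
          exact sum_congr rfl fun x _ => by ring
      _ ≤ R1 B l κ * (c1 B m κ * TL B m κ) :=
          mul_le_mul_of_nonneg_left (mul_le_mul_of_nonneg_left htailsm hc1m) hR1l
  calc ∑ x ∈ univ.filter (fun x : Fin n × Fin B => x.1 = I), ∑ w, Gr n B (m ^ 2) x w * Tob n B (l ^ 2) κ I w
      = ∑ x ∈ univ.filter (fun x : Fin n × Fin B => x.1 = I),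
          (∑ w ∈ univ.filter (fun w : Fin n × Fin B => w.1 = I), Gr n B (m ^ 2) x w * Tob n B (l ^ 2) κ I w
            + ∑ w ∈ univ.filter (fun w : Fin n × Fin B => w.1 ≠ I), Gr n B (m ^ 2) x w * Tob n B (l ^ 2) κ I w) :=
        sum_congr rfl fun x _ => sum_split_block _ I
    _ = ∑ x ∈ univ.filter (fun x : Fin n × Fin B => x.1 = I),
          ∑ w ∈ univ.filter (fun w : Fin n × Fin B => w.1 = I), Gr n B (m ^ 2) x w * Tob n B (l ^ 2) κ I w
        + ∑ x ∈ univ.filter (fun x : Fin n × Fin B => x.1 = I),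
          ∑ w ∈ univ.filter (fun w : Fin n × Fin B => w.1 ≠ I), Gr n B (m ^ 2) x w * Tob n B (l ^ 2) κ I w :=
        sum_add_distrib
    _ ≤ R0 m * (c1 B l κ * TL B l κ) + R1 B l κ * (c1 B m κ * TL B m κ) := add_le_add piece1 piece2

/-- the weighted out-of-block-`I` mass of the row `(K·G′)(w,·)`, `K = G_r(ν)`: `T³_I(w) := Σ_{w'} K(w,w')·T_I(w')`.
OURS (typing). [folklore] -/
def Tob3 (n B : ℕ) (μ ν κ : ℝ) (I : Fin n) (w : Fin n × Fin B) : ℝ :=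
  ∑ w', Gr n B ν w w' * Tob n B μ κ I w'

/-- **the first convolution layer**: splitting `w' ∈ I` (Toy7's `Tob_in_le`) from `w' ∉ I` (`Tob_le`),
`T³_I(w) ≤ c₁(m)·Σ_{w'∈I} K(w,w')·tails_m(o(w')) + R₁(m)·T_I^{(l)}(w)` at `μ = m²`, `ν = l²`. [folklore] -/
theorem Tob3_le (hm0 : 0 < m) (hm1 : m ≤ 1) (hl0 : 0 < l) (hκ : 0 ≤ κ) (hB : 0 < B)
    (hsm : 0 < m / 2 - κ / B) (I : Fin n) (w : Fin n × Fin B) :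
    Tob3 n B (m ^ 2) (l ^ 2) κ I w
      ≤ c1 B m κ * ∑ w' ∈ univ.filter (fun w' : Fin n × Fin B => w'.1 = I),
            Gr n B (l ^ 2) w w' * btail B (m / 2 - κ / B) w'.2.val
        + R1 B m κ * Tob n B (l ^ 2) κ I w := by
  have hν : 0 < l ^ 2 := by positivity
  have hK0 : ∀ w', 0 ≤ Gr n B (l ^ 2) w w' := Gr_nonneg hν w
  have hTin : ∀ w' ∈ univ.filter (fun w' : Fin n × Fin B => w'.1 = I),
      Tob n B (m ^ 2) κ I w' ≤ c1 B m κ * btail B (m / 2 - κ / B) w'.2.val :=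
    fun w' hw => Tob_in_le hm0 hm1 hκ hB hsm (mem_filter.mp hw).2
  have hTout : ∀ w', Tob n B (m ^ 2) κ I w' ≤ ewt n κ I w'.1 * R1 B m κ :=
    fun w' => Tob_le hm0 hm1 hκ hB hsm I w'
  unfold Tob3
  rw [sum_split_block _ I]
  refine add_le_add ?_ ?_
  · calc ∑ w' ∈ univ.filter (fun w' : Fin n × Fin B => w'.1 = I), Gr n B (l ^ 2) w w' * Tob n B (m ^ 2) κ I w'
        ≤ ∑ w' ∈ univ.filter (fun w' : Fin n × Fin B => w'.1 = I),
            Gr n B (l ^ 2) w w' * (c1 B m κ * btail B (m / 2 - κ / B) w'.2.val) :=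
          sum_le_sum fun w' hw => mul_le_mul_of_nonneg_left (hTin w' hw) (hK0 w')
      _ = _ := by
          rw [mul_sum]
          exact sum_congr rfl fun w' _ => by ring
  · calc ∑ w' ∈ univ.filter (fun w' : Fin n × Fin B => w'.1 ≠ I), Gr n B (l ^ 2) w w' * Tob n B (m ^ 2) κ I w'
        ≤ ∑ w' ∈ univ.filter (fun w' : Fin n × Fin B => w'.1 ≠ I),
            Gr n B (l ^ 2) w w' * (ewt n κ I w'.1 * R1 B m κ) :=
          sum_le_sum fun w' _ => mul_le_mul_of_nonneg_left (hTout w') (hK0 w')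
      _ = _ := by
          unfold Tob
          rw [mul_sum]
          exact sum_congr rfl fun w' _ => by ring

/-- THE REARRANGEMENT: `Σ_{J≠I} E₃(I,J)e^{κ|I−J|} = B⁻¹Σ_{x∈I}Σ_w G′(x,w)·T³_I(w)`. [folklore] -/
theorem E3_offdiag_weighted_eq (μ ν κ : ℝ) (I : Fin n) :
    ∑ J ∈ univ.filter (fun J : Fin n => J ≠ I), E3 n B μ ν I J * ewt n κ I J
      = (B : ℝ)⁻¹ * ∑ x ∈ univ.filter (fun x : Fin n × Fin B => x.1 = I),
          ∑ w, Gr n B μ x w * Tob3 n B μ ν κ I w := by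
  rw [E3_offdiag_weighted_eq']
  congr 1
  refine sum_congr rfl fun x _ => ?_
  simp only [GKG_apply, Tob3, Tob, mul_sum, sum_mul]
  rw [sum_comm]
  refine sum_congr rfl fun w _ => ?_
  rw [sum_comm]
  exact sum_congr rfl fun w' _ => sum_congr rfl fun z _ => by ring

/-- THE OFF-DIAGONAL BOUND FOR `E₃`:
`odB3 = B⁻¹[c₁(m)T_L(m)·R₀(m)R₀(l) + R₁(m)·(R₀(m)c₁(l)T_L(l) + R₁(l)c₁(m)T_L(m))]`. OURS (typing). [folklore] -/
def odB3 (B : ℕ) (m l κ : ℝ) : ℝ :=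
  (B : ℝ)⁻¹ * (c1 B m κ * TL B m κ * (R0 m * R0 l)
    + R1 B m κ * (R0 m * (c1 B l κ * TL B l κ) + R1 B l κ * (c1 B m κ * TL B m κ)))

/-- `odB3 ≥ 0`. [folklore] -/
theorem odB3_nonneg (hm0 : 0 < m) (hl0 : 0 < l) (hsm : 0 < m / 2 - κ / B) (hsl : 0 < l / 2 - κ / B) :
    0 ≤ odB3 B m l κ := by
  have := (c1_pos hm0 hsm).le; have := (c1_pos hl0 hsl).le
  have := (TL_pos (B := B) hsm).le; have := (TL_pos (B := B) hsl).le
  have := (R0_pos hm0).le; have := (R0_pos hl0).le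
  have := (R1_pos (B := B) hm0 hsm).le; have := (R1_pos (B := B) hl0 hsl).le
  unfold odB3
  positivity

/-- **THE OFF-DIAGONAL WEIGHTED ROW MASS OF `E₃`**: at `μ = m²`, `ν = l²`, `0 < m, l ≤ 1`, `0 ≤ κ`,
`m/2 − κ/B > 0`, `l/2 − κ/B > 0`, for every coarse block `I`, `Σ_{J≠I} E₃(I,J)·e^{κ|I−J|} ≤ odB3` — two layers:
`T³ ≤ c₁A + R₁T^{(l)}` (`Tob3_le`), then the in-block tail average `Σ_xΣ_w G′(x,w)A(w) ≤ R₀(m)R₀(l)T_L(m)` by two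
column sums, and the mixed sum by `mixed_offdiag_le`. [folklore] -/
theorem E3_offdiag_weighted_le (hm0 : 0 < m) (hm1 : m ≤ 1) (hl0 : 0 < l) (hl1 : l ≤ 1) (hκ : 0 ≤ κ) (hB : 0 < B)
    (hsm : 0 < m / 2 - κ / B) (hsl : 0 < l / 2 - κ / B) (I : Fin n) :
    ∑ J ∈ univ.filter (fun J : Fin n => J ≠ I), E3 n B (m ^ 2) (l ^ 2) I J * ewt n κ I J ≤ odB3 B m l κ := by
  have hμ : 0 < m ^ 2 := by positivity
  have hν : 0 < l ^ 2 := by positivity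
  have hG0 : ∀ x w, 0 ≤ Gr n B (m ^ 2) x w := Gr_nonneg hμ
  have hK0 : ∀ w w', 0 ≤ Gr n B (l ^ 2) w w' := Gr_nonneg hν
  have hc1m : 0 ≤ c1 B m κ := (c1_pos hm0 hsm).le
  have hR1m : 0 ≤ R1 B m κ := (R1_pos hm0 hsm).le
  have hR0m : 0 ≤ R0 m := (R0_pos hm0).le
  have hR0l : 0 ≤ R0 l := (R0_pos hl0).le
  have hbt : ∀ w : Fin n × Fin B, 0 ≤ btail B (m / 2 - κ / B) w.2.val := fun w => btail_nonneg _ _ _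
  have htails : ∑ w ∈ univ.filter (fun w : Fin n × Fin B => w.1 = I), btail B (m / 2 - κ / B) w.2.val
      ≤ TL B m κ := by
    unfold TL; exact sum_btail_le hsm I
  have hA0 : ∀ w : Fin n × Fin B, 0 ≤ ∑ w' ∈ univ.filter (fun w' : Fin n × Fin B => w'.1 = I),
      Gr n B (l ^ 2) w w' * btail B (m / 2 - κ / B) w'.2.val :=
    fun w => sum_nonneg fun w' _ => mul_nonneg (hK0 w w') (hbt w')
  rw [E3_offdiag_weighted_eq, odB3]
  refine mul_le_mul_of_nonneg_left ?_ (inv_nonneg.mpr (Nat.cast_nonneg _))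
  -- first layer
  have step1 : ∑ x ∈ univ.filter (fun x : Fin n × Fin B => x.1 = I),
      ∑ w, Gr n B (m ^ 2) x w * Tob3 n B (m ^ 2) (l ^ 2) κ I w
        ≤ ∑ x ∈ univ.filter (fun x : Fin n × Fin B => x.1 = I), ∑ w,
            (c1 B m κ * (Gr n B (m ^ 2) x w
                * ∑ w' ∈ univ.filter (fun w' : Fin n × Fin B => w'.1 = I),
                    Gr n B (l ^ 2) w w' * btail B (m / 2 - κ / B) w'.2.val)
              + R1 B m κ * (Gr n B (m ^ 2) x w * Tob n B (l ^ 2) κ I w)) := by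
    refine sum_le_sum fun x _ => sum_le_sum fun w _ => ?_
    calc Gr n B (m ^ 2) x w * Tob3 n B (m ^ 2) (l ^ 2) κ I w
        ≤ Gr n B (m ^ 2) x w
            * (c1 B m κ * ∑ w' ∈ univ.filter (fun w' : Fin n × Fin B => w'.1 = I),
                  Gr n B (l ^ 2) w w' * btail B (m / 2 - κ / B) w'.2.val
                + R1 B m κ * Tob n B (l ^ 2) κ I w) :=
          mul_le_mul_of_nonneg_left (Tob3_le hm0 hm1 hl0 hκ hB hsm I w) (hG0 x w)
      _ = _ := by ring
  have split : ∑ x ∈ univ.filter (fun x : Fin n × Fin B => x.1 = I), ∑ w,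
      (c1 B m κ * (Gr n B (m ^ 2) x w
          * ∑ w' ∈ univ.filter (fun w' : Fin n × Fin B => w'.1 = I),
              Gr n B (l ^ 2) w w' * btail B (m / 2 - κ / B) w'.2.val)
        + R1 B m κ * (Gr n B (m ^ 2) x w * Tob n B (l ^ 2) κ I w))
      = c1 B m κ * ∑ x ∈ univ.filter (fun x : Fin n × Fin B => x.1 = I), ∑ w, Gr n B (m ^ 2) x w
            * ∑ w' ∈ univ.filter (fun w' : Fin n × Fin B => w'.1 = I),
                Gr n B (l ^ 2) w w' * btail B (m / 2 - κ / B) w'.2.val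
        + R1 B m κ * ∑ x ∈ univ.filter (fun x : Fin n × Fin B => x.1 = I), ∑ w,
            Gr n B (m ^ 2) x w * Tob n B (l ^ 2) κ I w := by
    simp only [sum_add_distrib, mul_sum]
  -- second layer, the in-block tail average: two column sums
  have step2 : ∑ x ∈ univ.filter (fun x : Fin n × Fin B => x.1 = I), ∑ w, Gr n B (m ^ 2) x w
        * ∑ w' ∈ univ.filter (fun w' : Fin n × Fin B => w'.1 = I),
            Gr n B (l ^ 2) w w' * btail B (m / 2 - κ / B) w'.2.val
      ≤ R0 m * (R0 l * TL B m κ) := by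
    calc ∑ x ∈ univ.filter (fun x : Fin n × Fin B => x.1 = I), ∑ w, Gr n B (m ^ 2) x w
          * ∑ w' ∈ univ.filter (fun w' : Fin n × Fin B => w'.1 = I),
              Gr n B (l ^ 2) w w' * btail B (m / 2 - κ / B) w'.2.val
        = ∑ w, (∑ x ∈ univ.filter (fun x : Fin n × Fin B => x.1 = I), Gr n B (m ^ 2) x w)
            * ∑ w' ∈ univ.filter (fun w' : Fin n × Fin B => w'.1 = I),
                Gr n B (l ^ 2) w w' * btail B (m / 2 - κ / B) w'.2.val := by
          rw [sum_comm]
          exact sum_congr rfl fun w _ => (sum_mul _ _ _).symm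
      _ ≤ ∑ w, R0 m * ∑ w' ∈ univ.filter (fun w' : Fin n × Fin B => w'.1 = I),
            Gr n B (l ^ 2) w w' * btail B (m / 2 - κ / B) w'.2.val :=
          sum_le_sum fun w _ => mul_le_mul_of_nonneg_right (Gr_block_colsum_le hm0 hm1 I w) (hA0 w)
      _ = R0 m * ∑ w' ∈ univ.filter (fun w' : Fin n × Fin B => w'.1 = I),
            (∑ w, Gr n B (l ^ 2) w w') * btail B (m / 2 - κ / B) w'.2.val := by
          rw [← mul_sum, sum_comm]
          congr 1
          exact sum_congr rfl fun w' _ => (sum_mul _ _ _).symm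
      _ ≤ R0 m * ∑ w' ∈ univ.filter (fun w' : Fin n × Fin B => w'.1 = I),
            R0 l * btail B (m / 2 - κ / B) w'.2.val :=
          mul_le_mul_of_nonneg_left
            (sum_le_sum fun w' _ => mul_le_mul_of_nonneg_right (Gr_colsum_le hl0 hl1 w') (hbt w')) hR0m
      _ = R0 m * (R0 l * ∑ w' ∈ univ.filter (fun w' : Fin n × Fin B => w'.1 = I),
            btail B (m / 2 - κ / B) w'.2.val) := by
          rw [← mul_sum]
      _ ≤ R0 m * (R0 l * TL B m κ) :=
          mul_le_mul_of_nonneg_left (mul_le_mul_of_nonneg_left htails hR0l) hR0m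
  have step3 := mixed_offdiag_le hm0 hm1 hl0 hl1 hκ hB hsm hsl I
  calc ∑ x ∈ univ.filter (fun x : Fin n × Fin B => x.1 = I),
        ∑ w, Gr n B (m ^ 2) x w * Tob3 n B (m ^ 2) (l ^ 2) κ I w
      ≤ c1 B m κ * (R0 m * (R0 l * TL B m κ))
        + R1 B m κ * (R0 m * (c1 B l κ * TL B l κ) + R1 B l κ * (c1 B m κ * TL B m κ)) := by
        refine step1.trans ?_
        rw [split]
        exact add_le_add (mul_le_mul_of_nonneg_left step2 hc1m) (mul_le_mul_of_nonneg_left step3 hR1m)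
    _ = _ := by ring

end OffDiag3

/-! ## §4 The Woodbury coarse operator `M_C = ½(E₂ + ν·E₃)`: dominance, inverse in `𝒟(0, −4, c)` -/

section MCsec

variable {n B : ℕ} {N : Finset (Fin n)} {hN : N.Nonempty} {δ₀ : ℝ} {m l κ μ ν : ℝ}

/-- **THE WOODBURY COARSE OPERATOR OF THE TOY** (census §6 (a⁵) ff., note N14): `M_C(μ, ν) := ½(E₂(μ) + ν·E₃(μ, ν))`
— at `Λ = 2ν + ∂∂*`, `A = 0` this IS `C⁻¹ − Q′G′∂*(Λ + ∂∂*)⁻¹∂G′Q′*`, the coarse operator of the Woodbury form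
of the sequence datum `G` (`VG0U_eq`, §6). OURS (typing). [folklore] -/
def MC (n B : ℕ) (μ ν : ℝ) : Matrix (Fin n) (Fin n) ℝ := (1 / 2 : ℝ) • (E2 n B μ + ν • E3 n B μ ν)

/-- the entries of `M_C`. [folklore] -/
theorem MC_apply (μ ν : ℝ) (I J : Fin n) :
    MC n B μ ν I J = 1 / 2 * (E2 n B μ I J + ν * E3 n B μ ν I J) := by
  simp only [MC, Matrix.smul_apply, Matrix.add_apply, smul_eq_mul]

/-- `M_C` is entrywise non-negative for `μ, ν > 0`. [folklore] -/
theorem MC_nonneg (hμ : 0 < μ) (hν : 0 < ν) (I J : Fin n) : 0 ≤ MC n B μ ν I J := by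
  rw [MC_apply]
  exact mul_nonneg (by norm_num)
    (add_nonneg (E2_nonneg hμ I J) (mul_nonneg hν.le (E3_nonneg hμ hν I J)))

/-- **the diagonal of `M_C` from below comes free from `E₂`'s**: `E₂(I,I) ≥ d` ⇒ `M_C(I,I) ≥ d/2` (`E₃ ≥ 0`).
[folklore] -/
theorem MC_diag_ge (hμ : 0 < μ) (hν : 0 < ν) {d : ℝ} {I : Fin n} (hD : d ≤ E2 n B μ I I) :
    d / 2 ≤ MC n B μ ν I I := by
  rw [MC_apply]
  have := mul_nonneg hν.le (E3_nonneg (n := n) (B := B) hμ hν I I)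
  linarith

/-- the off-diagonal weighted row mass of `M_C`: `≤ ½(odB + l²·odB3)` at `μ = m²`, `ν = l²`. [folklore] -/
theorem MC_offdiag_weighted_le (hm0 : 0 < m) (hm1 : m ≤ 1) (hl0 : 0 < l) (hl1 : l ≤ 1) (hκ : 0 ≤ κ) (hB : 0 < B)
    (hsm : 0 < m / 2 - κ / B) (hsl : 0 < l / 2 - κ / B) (I : Fin n) :
    ∑ J ∈ univ.filter (fun J : Fin n => J ≠ I), MC n B (m ^ 2) (l ^ 2) I J * ewt n κ I J
      ≤ 1 / 2 * (odB B m κ + l ^ 2 * odB3 B m l κ) := by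
  have h2 := E2_offdiag_weighted_le (n := n) hm0 hm1 hκ hB hsm I
  have h3 := E3_offdiag_weighted_le (n := n) hm0 hm1 hl0 hl1 hκ hB hsm hsl I
  have e : ∀ J, MC n B (m ^ 2) (l ^ 2) I J * ewt n κ I J
      = 1 / 2 * (E2 n B (m ^ 2) I J * ewt n κ I J)
        + (1 / 2 * l ^ 2) * (E3 n B (m ^ 2) (l ^ 2) I J * ewt n κ I J) := by
    intro J; rw [MC_apply]; ring
  simp_rw [e]
  rw [sum_add_distrib, ← mul_sum, ← mul_sum]
  have hl2 : 0 ≤ l ^ 2 := sq_nonneg l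
  nlinarith

/-- **`M_C` IS INVERTIBLE WITH EXPONENTIALLY WEIGHTED ROW BOUNDS FOR `M_C⁻¹`** (parametric): at `μ = m²`, `ν = l²`,
with `E₂(I,I) ≥ d > 0` and `(odB + l²odB3)/d < 1`: `IsUnit M_C` and `Σ_J |M_C⁻¹(I,J)|e^{κ|I−J|} ≤
(1 − (odB + l²odB3)/d)⁻¹(d/2)⁻¹` (Toy6's engine `RowLe.inv_of_diag` on Toy7's `rowLe_of_offdiag`). [folklore] -/
theorem isUnit_MC_inv_rowLe (hm0 : 0 < m) (hm1 : m ≤ 1) (hl0 : 0 < l) (hl1 : l ≤ 1) (hκ : 0 ≤ κ) (hB : 0 < B)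
    (hsm : 0 < m / 2 - κ / B) (hsl : 0 < l / 2 - κ / B) {d : ℝ} (hd : 0 < d)
    (hD : ∀ I : Fin n, d ≤ E2 n B (m ^ 2) I I) (hq : (odB B m κ + l ^ 2 * odB3 B m l κ) / d < 1) :
    IsUnit (MC n B (m ^ 2) (l ^ 2))
      ∧ RowLe (ewt n κ) (MC n B (m ^ 2) (l ^ 2))⁻¹
          ((1 - (odB B m κ + l ^ 2 * odB3 B m l κ) / d)⁻¹ * (d / 2)⁻¹) := by
  have hμ : 0 < m ^ 2 := by positivity
  have hν : 0 < l ^ 2 := by positivity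
  have hd2 : 0 < d / 2 := by positivity
  have hD2 : ∀ I : Fin n, d / 2 ≤ MC n B (m ^ 2) (l ^ 2) I I := fun I => MC_diag_ge hμ hν (hD I)
  have h := rowLe_of_offdiag (isWt_ewt hκ) (MC_nonneg hμ hν) hd2 hD2
    (MC_offdiag_weighted_le hm0 hm1 hl0 hl1 hκ hB hsm hsl)
  have e : 1 / 2 * (odB B m κ + l ^ 2 * odB3 B m l κ) / (d / 2) = (odB B m κ + l ^ 2 * odB3 B m l κ) / d := by
    field_simp
  rw [e] at h
  exact RowLe.inv_of_diag (isWt_ewt hκ) (D := fun I => MC n B (m ^ 2) (l ^ 2) I I) hd2 hD2 hq h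

/-- **THE WOODBURY COARSE INVERSE IN ITS CLASS** (parametric): with `2(odB + l²odB3) ≤ d ≤ E₂(I,I)` and
`4d⁻¹ ≤ c·B⁻⁴`, `0 ≤ κ`, `δ₀ ≤ κ`: `M_C⁻¹ ∈ 𝒟(0, −4, c)` on the toy frame (`opDec_coarse_of_rowLe`). [folklore] -/
theorem MC_inv_opDec (hm0 : 0 < m) (hm1 : m ≤ 1) (hl0 : 0 < l) (hl1 : l ≤ 1) (hκ : 0 ≤ κ) (hB : 0 < B)
    (hsm : 0 < m / 2 - κ / B) (hsl : 0 < l / 2 - κ / B) (hδ : δ₀ ≤ κ) {d c : ℝ} (hd : 0 < d)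
    (hD : ∀ I : Fin n, d ≤ E2 n B (m ^ 2) I I) (h2 : 2 * (odB B m κ + l ^ 2 * odB3 B m l κ) ≤ d)
    (hc : 4 * d⁻¹ ≤ c * (B : ℝ) ^ (-4 : ℤ)) :
    OpDec (toyFrame n B N hN δ₀) id id id id 0 (-4) c (MC n B (m ^ 2) (l ^ 2))⁻¹ := by
  have hq : (odB B m κ + l ^ 2 * odB3 B m l κ) / d ≤ 1 / 2 := by
    rw [div_le_iff₀ hd]; linarith
  obtain ⟨-, hR⟩ := isUnit_MC_inv_rowLe hm0 hm1 hl0 hl1 hκ hB hsm hsl hd hD (by linarith)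
  have hfac : (1 - (odB B m κ + l ^ 2 * odB3 B m l κ) / d)⁻¹ ≤ 2 := by
    rw [inv_le_comm₀ (by linarith) (by norm_num)]
    linarith
  have e : (2 : ℝ) * (d / 2)⁻¹ = 4 * d⁻¹ := by
    field_simp; ring
  have hR' : RowLe (ewt n κ) (MC n B (m ^ 2) (l ^ 2))⁻¹ (4 * d⁻¹) := by
    rw [← e]
    exact rowLe_mono hR (mul_le_mul_of_nonneg_right hfac (inv_nonneg.mpr (by positivity)))
  have hB4 : (0 : ℝ) < (B : ℝ) ^ (-4 : ℤ) := zpow_pos (by exact_mod_cast hB) _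
  have hc0 : 0 ≤ c := by
    refine le_of_mul_le_mul_right ?_ hB4
    rw [zero_mul]
    exact le_trans (by positivity) hc
  exact opDec_coarse_of_rowLe hκ hδ hR' hc0 hc

end MCsec

/-! ## §5 The numeric corollary: `κ = 1/2`, `μ = ν = (a/B)²`, `2²⁰ ≤ a ≤ B` ⇒ `M_C⁻¹ ∈ 𝒟(0, −4, 6a⁴)` -/

section Numeric3

variable {n B : ℕ} {N : Finset (Fin n)} {hN : N.Nonempty} {δ₀ : ℝ} {a : ℝ}

/-- **THE OFF-DIAGONAL MASS OF `E₃`, NUMERICALLY**: `odB3 ≤ 376320·B⁶/(a³(a−1)⁴)` at `κ = 1/2`, `m = l = a/B`,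
`1 < a ≤ B` (Toy7's `R₀ ≤ 24B²/a²`, `R₁ ≤ 40B²/(a(a−1))`, `c₁T_L ≤ 120B³/(a(a−1)²)`). [folklore] -/
theorem odB3_num_le (ha : 1 < a) (haB : a ≤ (B : ℝ)) :
    odB3 B (a / B) (a / B) (1 / 2) ≤ 376320 * (B : ℝ) ^ 6 / (a ^ 3 * (a - 1) ^ 4) := by
  have ha0 : 0 < a := by linarith
  have hBr : (0 : ℝ) < B := by linarith
  have ha1 : 0 < a - 1 := by linarith
  have ha1' : a - 1 ≠ 0 := ha1.ne'
  have hs : 0 < a / B / 2 - 1 / 2 / (B : ℝ) := by rw [srate_eq]; positivity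
  have hR0 := R0_num_le ha0 haB
  have hR1 := R1_num_le ha haB
  have hc1 := c1_num_le ha haB
  have hTL := TL_num_le ha haB
  have hR0n : 0 ≤ R0 (a / B) := (R0_pos (by positivity)).le
  have hR1n : 0 ≤ R1 B (a / B) (1 / 2) := (R1_pos (by positivity) hs).le
  have hR0' : R0 (a / B) ≤ 24 * (B : ℝ) ^ 2 / (a * (a - 1)) := by
    refine hR0.trans (div_le_div_of_nonneg_left (by positivity) (by positivity) ?_)
    nlinarith
  have hprod : c1 B (a / B) (1 / 2) * TL B (a / B) (1 / 2) ≤ 120 * (B : ℝ) ^ 3 / (a * (a - 1) ^ 2) := by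
    calc c1 B (a / B) (1 / 2) * TL B (a / B) (1 / 2)
        ≤ (20 * (B : ℝ) ^ 2 / (a * (a - 1))) * (6 * B / (a - 1)) :=
          mul_le_mul hc1 hTL (TL_pos hs).le (by positivity)
      _ = 120 * (B : ℝ) ^ 3 / (a * (a - 1) ^ 2) := by field_simp; ring
  have hct : 0 ≤ c1 B (a / B) (1 / 2) * TL B (a / B) (1 / 2) :=
    mul_nonneg (c1_pos (by positivity) hs).le (TL_pos hs).le
  have hq : R0 (a / B) ^ 2 + R0 (a / B) * R1 B (a / B) (1 / 2) + R1 B (a / B) (1 / 2) ^ 2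
      ≤ 3136 * (B : ℝ) ^ 4 / (a ^ 2 * (a - 1) ^ 2) := by
    have h1 : R0 (a / B) ^ 2 ≤ (24 * (B : ℝ) ^ 2 / (a * (a - 1))) ^ 2 := pow_le_pow_left₀ hR0n hR0' 2
    have h2 : R0 (a / B) * R1 B (a / B) (1 / 2)
        ≤ (24 * (B : ℝ) ^ 2 / (a * (a - 1))) * (40 * (B : ℝ) ^ 2 / (a * (a - 1))) :=
      mul_le_mul hR0' hR1 hR1n (by positivity)
    have h3 : R1 B (a / B) (1 / 2) ^ 2 ≤ (40 * (B : ℝ) ^ 2 / (a * (a - 1))) ^ 2 := pow_le_pow_left₀ hR1n hR1 2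
    have e : (24 * (B : ℝ) ^ 2 / (a * (a - 1))) ^ 2
        + (24 * (B : ℝ) ^ 2 / (a * (a - 1))) * (40 * (B : ℝ) ^ 2 / (a * (a - 1)))
        + (40 * (B : ℝ) ^ 2 / (a * (a - 1))) ^ 2 = 3136 * (B : ℝ) ^ 4 / (a ^ 2 * (a - 1) ^ 2) := by
      field_simp; ring
    linarith
  have hq0 : 0 ≤ R0 (a / B) ^ 2 + R0 (a / B) * R1 B (a / B) (1 / 2) + R1 B (a / B) (1 / 2) ^ 2 := by
    positivity
  have e : odB3 B (a / B) (a / B) (1 / 2) = (B : ℝ)⁻¹ * ((c1 B (a / B) (1 / 2) * TL B (a / B) (1 / 2))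
      * (R0 (a / B) ^ 2 + R0 (a / B) * R1 B (a / B) (1 / 2) + R1 B (a / B) (1 / 2) ^ 2)) := by
    unfold odB3; ring
  rw [e]
  calc (B : ℝ)⁻¹ * ((c1 B (a / B) (1 / 2) * TL B (a / B) (1 / 2))
        * (R0 (a / B) ^ 2 + R0 (a / B) * R1 B (a / B) (1 / 2) + R1 B (a / B) (1 / 2) ^ 2))
      ≤ (B : ℝ)⁻¹ * ((120 * (B : ℝ) ^ 3 / (a * (a - 1) ^ 2)) * (3136 * (B : ℝ) ^ 4 / (a ^ 2 * (a - 1) ^ 2))) :=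
        mul_le_mul_of_nonneg_left (mul_le_mul hprod hq hq0 (by positivity)) (inv_nonneg.mpr hBr.le)
    _ = 376320 * (B : ℝ) ^ 6 / (a ^ 3 * (a - 1) ^ 4) := by field_simp; ring

/-- **THE TOTAL OFF-DIAGONAL MASS OF `2M_C`, NUMERICALLY**: `odB + (a/B)²·odB3 ≤ 384000·B⁴/(a(a−1)⁴)` at
`κ = 1/2`, `m = l = a/B`, `1 < a ≤ B` — of relative size `O(1/a)` against the diagonal `≍ B⁴/a⁴`. [folklore] -/
theorem offmass_num_le (ha : 1 < a) (haB : a ≤ (B : ℝ)) :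
    odB B (a / B) (1 / 2) + (a / B) ^ 2 * odB3 B (a / B) (a / B) (1 / 2)
      ≤ 384000 * (B : ℝ) ^ 4 / (a * (a - 1) ^ 4) := by
  have ha0 : 0 < a := by linarith
  have hBr : (0 : ℝ) < B := by linarith
  have ha1 : 0 < a - 1 := by linarith
  have ha1' : a - 1 ≠ 0 := ha1.ne'
  have h1 : odB B (a / B) (1 / 2) ≤ 7680 * (B : ℝ) ^ 4 / (a * (a - 1) ^ 4) := by
    refine (odB_num_le ha haB).trans (div_le_div_of_nonneg_left (by positivity) (by positivity) ?_)
    have e : a ^ 2 * (a - 1) ^ 3 - a * (a - 1) ^ 4 = a * (a - 1) ^ 3 := by ring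
    have : 0 ≤ a * (a - 1) ^ 3 := by positivity
    linarith
  have h2 : (a / B) ^ 2 * odB3 B (a / B) (a / B) (1 / 2) ≤ 376320 * (B : ℝ) ^ 4 / (a * (a - 1) ^ 4) := by
    calc (a / B) ^ 2 * odB3 B (a / B) (a / B) (1 / 2)
        ≤ (a / B) ^ 2 * (376320 * (B : ℝ) ^ 6 / (a ^ 3 * (a - 1) ^ 4)) :=
          mul_le_mul_of_nonneg_left (odB3_num_le ha haB) (by positivity)
      _ = 376320 * (B : ℝ) ^ 4 / (a * (a - 1) ^ 4) := by field_simp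
  have e : 7680 * (B : ℝ) ^ 4 / (a * (a - 1) ^ 4) + 376320 * (B : ℝ) ^ 4 / (a * (a - 1) ^ 4)
      = 384000 * (B : ℝ) ^ 4 / (a * (a - 1) ^ 4) := by ring
  linarith

/-- the dominance inequality of the threshold: `768000a⁵ ≤ (a−1)⁴(a−6)²` for `a ≥ 2²⁰ = 1048576`. [folklore] -/
theorem threshold_poly3 (ha : 1048576 ≤ a) : 768000 * a ^ 5 ≤ (a - 1) ^ 4 * (a - 6) ^ 2 := by
  have h0 : 0 ≤ 255 / 256 * a := by linarith
  have h1 : 255 / 256 * a ≤ a - 1 := by linarith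
  have h2 : 255 / 256 * a ≤ a - 6 := by linarith
  have h3 : (255 / 256 * a) ^ 4 ≤ (a - 1) ^ 4 := pow_le_pow_left₀ h0 h1 4
  have h4 : (255 / 256 * a) ^ 2 ≤ (a - 6) ^ 2 := pow_le_pow_left₀ h0 h2 2
  have h5 : (255 / 256 * a) ^ 4 * (255 / 256 * a) ^ 2 ≤ (a - 1) ^ 4 * (a - 6) ^ 2 :=
    mul_le_mul h3 h4 (by positivity) (pow_nonneg (by linarith) 4)
  have h6 : 768000 * a ^ 5 ≤ (255 / 256 * a) ^ 4 * (255 / 256 * a) ^ 2 := by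
    have e : (255 / 256 * a) ^ 4 * (255 / 256 * a) ^ 2 = (255 / 256) ^ 6 * a * a ^ 5 := by ring
    rw [e]
    have ha5 : 0 ≤ a ^ 5 := by positivity
    have h7 : (768000 : ℝ) ≤ (255 / 256) ^ 6 * a := by nlinarith
    nlinarith
  linarith

/-- **DOMINANCE BY A FACTOR TWO**: `2·(384000B⁴/(a(a−1)⁴)) ≤ B⁴(a−6)²/a⁶` for `a ≥ 2²⁰`. [folklore] -/
theorem dominance3_num (ha : 1048576 ≤ a) (hBr : (0 : ℝ) < B) :
    2 * (384000 * (B : ℝ) ^ 4 / (a * (a - 1) ^ 4)) ≤ (B : ℝ) ^ 4 * (a - 6) ^ 2 / a ^ 6 := by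
  have ha0 : 0 < a := by linarith
  have ha1 : 0 < a - 1 := by linarith
  have ha1' : a - 1 ≠ 0 := ha1.ne'
  have hP := threshold_poly3 ha
  have hX : 0 ≤ (B : ℝ) ^ 4 / (a ^ 6 * (a - 1) ^ 4) := by positivity
  have e1 : 2 * (384000 * (B : ℝ) ^ 4 / (a * (a - 1) ^ 4))
      = (768000 * a ^ 5) * ((B : ℝ) ^ 4 / (a ^ 6 * (a - 1) ^ 4)) := by
    field_simp; ring
  have e2 : (B : ℝ) ^ 4 * (a - 6) ^ 2 / a ^ 6
      = ((a - 1) ^ 4 * (a - 6) ^ 2) * ((B : ℝ) ^ 4 / (a ^ 6 * (a - 1) ^ 4)) := by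
    field_simp
  rw [e1, e2]
  exact mul_le_mul_of_nonneg_right hP hX

/-- **THE CONSTANT**: `4·(B⁴(a−6)²/a⁶)⁻¹ ≤ 6a⁴·B⁻⁴` for `a ≥ 2²⁰` (`2a² ≤ 3(a−6)²`). [folklore] -/
theorem constant3_num (ha : 1048576 ≤ a) (hBr : (0 : ℝ) < B) :
    4 * ((B : ℝ) ^ 4 * (a - 6) ^ 2 / a ^ 6)⁻¹ ≤ 6 * a ^ 4 * (B : ℝ) ^ (-4 : ℤ) := by
  have h := constant_num (B := B) (a := a) (by linarith) hBr
  have e : 6 * a ^ 4 * (B : ℝ) ^ (-4 : ℤ) = 2 * (3 * a ^ 4 * (B : ℝ) ^ (-4 : ℤ)) := by ring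
  rw [e]
  linarith

/-- **`M_C((a/B)², (a/B)²)` IS INVERTIBLE** for `2²⁰ ≤ a ≤ B`, with
`Σ_J |M_C⁻¹(I,J)|e^{|I−J|/2} ≤ 4a⁶/(B⁴(a−6)²)`. [folklore] -/
theorem isUnit_MC_num (ha : 1048576 ≤ a) (haB : a ≤ (B : ℝ)) :
    IsUnit (MC n B ((a / B) ^ 2) ((a / B) ^ 2))
      ∧ RowLe (ewt n (1 / 2)) (MC n B ((a / B) ^ 2) ((a / B) ^ 2))⁻¹
          (4 * ((B : ℝ) ^ 4 * (a - 6) ^ 2 / a ^ 6)⁻¹) := by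
  have ha0 : 0 < a := by linarith
  have ha1 : 1 < a := by linarith
  have hBr : (0 : ℝ) < B := by linarith
  have hB : 0 < B := by exact_mod_cast hBr
  have hm0 : 0 < a / B := by positivity
  have hm1 : a / B ≤ 1 := by rwa [div_le_one hBr]
  have hs : 0 < a / B / 2 - 1 / 2 / (B : ℝ) := by
    rw [srate_eq]; have : 0 < a - 1 := by linarith
    positivity
  have hd : 0 < (B : ℝ) ^ 4 * (a - 6) ^ 2 / a ^ 6 :=
    div_pos (mul_pos (by positivity) (pow_pos (by linarith) 2)) (by positivity)
  have hD : ∀ I : Fin n, (B : ℝ) ^ 4 * (a - 6) ^ 2 / a ^ 6 ≤ E2 n B ((a / B) ^ 2) I I :=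
    fun I => E2_diag_ge_num (by linarith) haB I
  have h2 : 2 * (odB B (a / B) (1 / 2) + (a / B) ^ 2 * odB3 B (a / B) (a / B) (1 / 2))
      ≤ (B : ℝ) ^ 4 * (a - 6) ^ 2 / a ^ 6 :=
    le_trans (mul_le_mul_of_nonneg_left (offmass_num_le ha1 haB) zero_le_two) (dominance3_num ha hBr)
  have hq : (odB B (a / B) (1 / 2) + (a / B) ^ 2 * odB3 B (a / B) (a / B) (1 / 2))
      / ((B : ℝ) ^ 4 * (a - 6) ^ 2 / a ^ 6) ≤ 1 / 2 := by
    rw [div_le_iff₀ hd]; linarith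
  obtain ⟨hU, hR⟩ := isUnit_MC_inv_rowLe hm0 hm1 hm0 hm1 (by norm_num) hB hs hs hd hD (by linarith)
  refine ⟨hU, rowLe_mono hR ?_⟩
  have hfac : (1 - (odB B (a / B) (1 / 2) + (a / B) ^ 2 * odB3 B (a / B) (a / B) (1 / 2))
      / ((B : ℝ) ^ 4 * (a - 6) ^ 2 / a ^ 6))⁻¹ ≤ 2 := by
    rw [inv_le_comm₀ (by linarith) (by norm_num)]
    linarith
  have e : (4 : ℝ) * ((B : ℝ) ^ 4 * (a - 6) ^ 2 / a ^ 6)⁻¹ = 2 * ((B : ℝ) ^ 4 * (a - 6) ^ 2 / a ^ 6 / 2)⁻¹ := by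
    field_simp; ring
  rw [e]
  exact mul_le_mul_of_nonneg_right hfac (inv_nonneg.mpr (by positivity))

/-- **THE WOODBURY COARSE INVERSE OF THE TOY IN ITS CLASS** (census §6 (a⁵) ff., note N14): for `2²⁰ ≤ a ≤ B` and
`δ₀ ≤ 1/2`, `M_C((a/B)², (a/B)²)⁻¹ ∈ 𝒟(0, −4, 6a⁴)` on `toyFrame n B N hN δ₀` — the class of the cut model's coarse
inverse, constants free of `B`, `n`, `N`. [folklore] -/
theorem MC_inv_opDec_num (ha : 1048576 ≤ a) (haB : a ≤ (B : ℝ)) (hδ : δ₀ ≤ 1 / 2) :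
    OpDec (toyFrame n B N hN δ₀) id id id id 0 (-4) (6 * a ^ 4) (MC n B ((a / B) ^ 2) ((a / B) ^ 2))⁻¹ := by
  have ha0 : 0 < a := by linarith
  have ha1 : 1 < a := by linarith
  have hBr : (0 : ℝ) < B := by linarith
  have hB : 0 < B := by exact_mod_cast hBr
  have hm0 : 0 < a / B := by positivity
  have hm1 : a / B ≤ 1 := by rwa [div_le_one hBr]
  have hs : 0 < a / B / 2 - 1 / 2 / (B : ℝ) := by
    rw [srate_eq]; have : 0 < a - 1 := by linarith
    positivity
  have hd : 0 < (B : ℝ) ^ 4 * (a - 6) ^ 2 / a ^ 6 :=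
    div_pos (mul_pos (by positivity) (pow_pos (by linarith) 2)) (by positivity)
  exact MC_inv_opDec hm0 hm1 hm0 hm1 (by norm_num) hB hs hs hδ hd (fun I => E2_diag_ge_num (by linarith) haB I)
    (le_trans (mul_le_mul_of_nonneg_left (offmass_num_le ha1 haB) zero_le_two) (dominance3_num ha hBr))
    (constant3_num ha hBr)

end Numeric3

/-! ## §6 The push-through and Woodbury identities: the sequence datum `G` of the toy in closed form -/

section Woodbury

/-- **THE WOODBURY IDENTITY, abstractly** (rectangular `U`, `V`): if `G₀H = 1`, `EC = 1`, `VG₀U = E − M` and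
`M⁻M = 1`, then `(G₀ + G₀UM⁻VG₀)(H − UCV) = 1`. [folklore] -/
theorem woodbury_mul_eq_one {α β : Type*} [Fintype α] [DecidableEq α] [Fintype β] [DecidableEq β]
    {H G₀ : Matrix α α ℝ} {U : Matrix α β ℝ} {V : Matrix β α ℝ} {E C M Mi : Matrix β β ℝ}
    (hG : G₀ * H = 1) (hEC : E * C = 1) (hM : V * G₀ * U = E - M) (hMi : Mi * M = 1) :
    (G₀ + G₀ * U * Mi * V * G₀) * (H - U * C * V) = 1 := by
  have t3 : G₀ * U * Mi * V * G₀ * H = G₀ * U * Mi * V := by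
    rw [Matrix.mul_assoc (G₀ * U * Mi * V), hG, Matrix.mul_one]
  have t4 : G₀ * U * Mi * V * G₀ * (U * C * V) = G₀ * U * Mi * V - G₀ * U * C * V := by
    have e1 : G₀ * U * Mi * V * G₀ * (U * C * V) = G₀ * U * Mi * (V * G₀ * U) * C * V := by
      simp only [Matrix.mul_assoc]
    rw [e1, hM, Matrix.mul_sub, Matrix.sub_mul, Matrix.sub_mul]
    have e2 : G₀ * U * Mi * E * C * V = G₀ * U * Mi * V := by
      rw [Matrix.mul_assoc (G₀ * U * Mi), hEC, Matrix.mul_one]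
    have e3 : G₀ * U * Mi * M * C * V = G₀ * U * C * V := by
      rw [Matrix.mul_assoc (G₀ * U), hMi, Matrix.mul_one]
    rw [e2, e3]
  have e4 : G₀ * (U * C * V) = G₀ * U * C * V := by simp only [Matrix.mul_assoc]
  rw [Matrix.add_mul, Matrix.mul_sub, Matrix.mul_sub, hG, t3, t4, e4]
  abel

variable {n B : ℕ} {μ ν a : ℝ}

/-- `G₀H₀ = 1` (Toy6's `Hd_mul_Gd`, commuted). [folklore] -/
theorem Gd_mul_Hd (hν : 0 < ν) : Gd n B ν * Hd n B ν = 1 := mul_eq_one_comm.mp (Hd_mul_Gd hν)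

/-- **THE PUSH-THROUGH IDENTITY**: `∂*(∂∂* + ν)⁻¹∂ = 1 − ν(∂*∂ + ν)⁻¹`, i.e. `Dbw·Gd(ν)·Dfw = 1 − ν·Gr(ν)` (from
`H_ν∂* = ∂*H₀,ν`). [folklore] -/
theorem Dbw_Gd_Dfw (hν : 0 < ν) : Dbw n B * Gd n B ν * Dfw n B = 1 - ν • Gr n B ν := by
  have h1 : Hm n B ν * Dbw n B = Dbw n B * Hd n B ν := by
    unfold Hm Hd
    simp only [Matrix.add_mul, Matrix.mul_add, Matrix.smul_mul, Matrix.mul_smul, Matrix.one_mul, Matrix.mul_one,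
      Matrix.mul_assoc]
  have h2 : Dbw n B * Gd n B ν = Gr n B ν * Dbw n B := by
    calc Dbw n B * Gd n B ν = Gr n B ν * Hm n B ν * Dbw n B * Gd n B ν := by rw [Gr_mul_Hm hν, Matrix.one_mul]
      _ = Gr n B ν * (Hm n B ν * Dbw n B) * Gd n B ν := by rw [Matrix.mul_assoc (Gr n B ν)]
      _ = Gr n B ν * (Dbw n B * Hd n B ν) * Gd n B ν := by rw [h1]
      _ = Gr n B ν * Dbw n B := by rw [Matrix.mul_assoc, Matrix.mul_assoc, Hd_mul_Gd hν, Matrix.mul_one]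
  have h3 : Dbw n B * Dfw n B = Hm n B ν - ν • (1 : Matrix (Fin n × Fin B) (Fin n × Fin B) ℝ) := by
    unfold Hm; rw [add_sub_cancel_right]
  rw [h2, Matrix.mul_assoc, h3, Matrix.mul_sub, Gr_mul_Hm hν, Matrix.mul_smul, Matrix.mul_one]

/-- the zeroth-order operator of the Leibniz block at `b = 1` (Toy4 §6): `Λ(ν) := 2ν·1 + ∂∂*`. OURS (typing).
[folklore] -/
def Lam (n B : ℕ) (ν : ℝ) : Matrix (Fin n × Fin B) (Fin n × Fin B) ℝ :=
  (2 * ν) • (1 : Matrix (Fin n × Fin B) (Fin n × Fin B) ℝ) + Dfw n B * Dbw n B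

/-- `Λ` is Toy4's `a·1 + b·∂∂*` (`leibniz_affine`) at `a = 2ν`, `b = 1`. [folklore] -/
theorem Lam_eq_affine (ν : ℝ) :
    Lam n B ν = (2 * ν) • (1 : Matrix (Fin n × Fin B) (Fin n × Fin B) ℝ) + (1 : ℝ) • (Dfw n B * Dbw n B) := by
  rw [one_smul]; rfl

/-- `Λ + ∂∂* = 2·H₀,ν`. [folklore] -/
theorem Lam_add_DDt (ν : ℝ) : Lam n B ν + Dfw n B * Dbw n B = (2 : ℝ) • Hd n B ν := by
  unfold Lam Hd
  ext x y
  simp only [Matrix.add_apply, Matrix.smul_apply, smul_eq_mul]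
  ring

/-- the Woodbury skeleton `G₀ := (Λ + ∂∂*)⁻¹ = ½·Gd(ν)`. OURS (typing). [folklore] -/
def G0 (n B : ℕ) (ν : ℝ) : Matrix (Fin n × Fin B) (Fin n × Fin B) ℝ := (1 / 2 : ℝ) • Gd n B ν

/-- `G₀(Λ + ∂∂*) = 1`. [folklore] -/
theorem G0_mul (hν : 0 < ν) : G0 n B ν * (Lam n B ν + Dfw n B * Dbw n B) = 1 := by
  rw [Lam_add_DDt, G0, Matrix.smul_mul, Matrix.mul_smul, smul_smul, Gd_mul_Hd hν]
  norm_num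

/-- `∂*G₀∂ = ½(1 − ν·Gr(ν))`. [folklore] -/
theorem Dbw_G0_Dfw (hν : 0 < ν) :
    Dbw n B * G0 n B ν * Dfw n B = (1 / 2 : ℝ) • (1 - ν • Gr n B ν) := by
  unfold G0; rw [Matrix.mul_smul, Matrix.smul_mul, Dbw_Gd_Dfw hν]

/-- **THE COARSE OPERATOR OF THE WOODBURY FORM IS `M_C`**: with `U := ∂G′Q′ᵗ`, `V := Q′G′∂*`,
`VG₀U = ½E₂ − (ν/2)E₃ = E₂ − M_C`. [folklore] -/
theorem VG0U_eq (hν : 0 < ν) (μ : ℝ) :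
    Qp n B * Gr n B μ * Dbw n B * G0 n B ν * (Dfw n B * Gr n B μ * Qpt n B) = E2 n B μ - MC n B μ ν := by
  calc Qp n B * Gr n B μ * Dbw n B * G0 n B ν * (Dfw n B * Gr n B μ * Qpt n B)
      = Qp n B * Gr n B μ * (Dbw n B * G0 n B ν * Dfw n B) * (Gr n B μ * Qpt n B) := by
        simp only [Matrix.mul_assoc]
    _ = Qp n B * Gr n B μ * ((1 / 2 : ℝ) • (1 - ν • Gr n B ν)) * (Gr n B μ * Qpt n B) := by rw [Dbw_G0_Dfw hν]
    _ = E2 n B μ - MC n B μ ν := by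
        unfold MC E2 E3
        simp only [Matrix.mul_smul, Matrix.smul_mul, Matrix.mul_sub, Matrix.sub_mul, Matrix.mul_one,
          Matrix.mul_assoc, smul_sub, smul_add, smul_smul]
        ext I J
        simp only [Matrix.sub_apply, Matrix.add_apply, Matrix.smul_apply, smul_eq_mul]
        ring

/-- **THE SEQUENCE DATUM OF THE TOY IN CLOSED FORM**: `G := G₀ + G₀·∂G′Q′ᵗ·M_C⁻¹·Q′G′∂*·G₀`. OURS (typing).
[folklore] -/
def Gtoy (n B : ℕ) (μ ν : ℝ) : Matrix (Fin n × Fin B) (Fin n × Fin B) ℝ :=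
  G0 n B ν + G0 n B ν * (Dfw n B * Gr n B μ * Qpt n B) * (MC n B μ ν)⁻¹ * (Qp n B * Gr n B μ * Dbw n B) * G0 n B ν

/-- **THE `hG₁` SHAPE OF THE CUT MODEL WITH `∂ ≠ 0`** (parametric): if `E₂(μ)` and `M_C(μ, ν)` are invertible then
`G·(Λ + A + ∂(1 − G′Q′ᵗCQ′G′)∂*) = 1` with `Λ = 2ν + ∂∂*`, `A = 0`, `C = E₂⁻¹` — the field `TwoSeq.hG₁` of
`…B9SectCDiffExpansion` read on the toy line (`woodbury_mul_eq_one` + `VG0U_eq`). [folklore] -/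
theorem Gtoy_mul_eq_one (hν : 0 < ν) (hE : IsUnit (E2 n B μ)) (hM : IsUnit (MC n B μ ν)) :
    Gtoy n B μ ν * (Lam n B ν + 0
      + Dfw n B * (1 - Gr n B μ * Qpt n B * (E2 n B μ)⁻¹ * Qp n B * Gr n B μ) * Dbw n B) = 1 := by
  have hEC : E2 n B μ * (E2 n B μ)⁻¹ = 1 :=
    Matrix.mul_nonsing_inv _ ((Matrix.isUnit_iff_isUnit_det _).mp hE)
  have hMi : (MC n B μ ν)⁻¹ * MC n B μ ν = 1 :=
    Matrix.nonsing_inv_mul _ ((Matrix.isUnit_iff_isUnit_det _).mp hM)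
  have key := woodbury_mul_eq_one (G0_mul hν) hEC (VG0U_eq hν μ) hMi
  have e : Lam n B ν + 0 + Dfw n B * (1 - Gr n B μ * Qpt n B * (E2 n B μ)⁻¹ * Qp n B * Gr n B μ) * Dbw n B
      = Lam n B ν + Dfw n B * Dbw n B
        - Dfw n B * Gr n B μ * Qpt n B * (E2 n B μ)⁻¹ * (Qp n B * Gr n B μ * Dbw n B) := by
    rw [add_zero, Matrix.mul_sub, Matrix.sub_mul, Matrix.mul_one]
    simp only [Matrix.mul_assoc]
    abel
  unfold Gtoy
  rw [e]
  exact key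

/-- the `hG'₁` SHAPE with `∂ ≠ 0`: `G′·(∂*∂ + Λ′ + A′) = 1` at `Λ′ = μ·1`, `A′ = 0` (Toy5's `Gr_mul_Hm`). [folklore] -/
theorem Gr_hG'_shape (hμ : 0 < μ) :
    Gr n B μ * (Dbw n B * Dfw n B + μ • (1 : Matrix (Fin n × Fin B) (Fin n × Fin B) ℝ) + 0) = 1 := by
  rw [add_zero]; exact Gr_mul_Hm hμ

/-- the `hC₁` SHAPE with `∂ ≠ 0`: `C·(Q′G′G′Q′ᵗ) = 1` at `C = E₂⁻¹`. [folklore] -/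
theorem E2inv_hC_shape (hE : IsUnit (E2 n B μ)) :
    (E2 n B μ)⁻¹ * (Qp n B * Gr n B μ * Gr n B μ * Qpt n B) = 1 := by
  have e : Qp n B * Gr n B μ * Gr n B μ * Qpt n B = E2 n B μ := by
    unfold E2; simp only [Matrix.mul_assoc]
  rw [e]
  exact Matrix.nonsing_inv_mul _ ((Matrix.isUnit_iff_isUnit_det _).mp hE)

/-- **NUMERIC COROLLARY**: for `2²⁰ ≤ a ≤ B`, at `μ = ν = (a/B)²`, the three proof-field SHAPES `hG'₁`, `hC₁`, `hG₁`
of `TwoSeq` are inhabited on the toy line by `G′ = Gr`, `C = E₂⁻¹ ∈ 𝒟(0,−4,3a⁴)` (Toy7), `G = Gtoy` with its coarse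
inverse `M_C⁻¹ ∈ 𝒟(0,−4,6a⁴)` (§5). [folklore] -/
theorem Gtoy_mul_eq_one_num (ha : 1048576 ≤ a) (haB : a ≤ (B : ℝ)) :
    Gtoy n B ((a / B) ^ 2) ((a / B) ^ 2) * (Lam n B ((a / B) ^ 2) + 0
      + Dfw n B * (1 - Gr n B ((a / B) ^ 2) * Qpt n B * (E2 n B ((a / B) ^ 2))⁻¹ * Qp n B * Gr n B ((a / B) ^ 2))
        * Dbw n B) = 1 := by
  have ha0 : 0 < a := by linarith
  have hBr : (0 : ℝ) < B := by linarith
  have hm : 0 < (a / B) ^ 2 := by positivity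
  exact Gtoy_mul_eq_one hm (isUnit_E2_num (by linarith) haB).1 (isUnit_MC_num ha haB).1

end Woodbury




end

end Literature.MathematicalPhysics.QuantumFieldTheory.Balaban1983to89.B9SectCDiffCutModelToy8
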